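import Summits.RiemannHypothesis.RiemannHypothesis.Theorems.WeilColumnThetaPRStep3ZeroDecay
import Summits.RiemannHypothesis.RiemannHypothesis.Theorems.WeilColumnZeroSumDecay
import Summits.RiemannHypothesis.RiemannHypothesis.Theorems.WeilColumnZeroSideBilinear
import Literature.NumberTheory.LFunctions.FordZetaZeroRecipSqSum
import HarnessLib

/-!
# THETA kernel certificate, (P_R) Steps 0, 1, 4: the split `φ_k = GR_k − TR_k`, the polarisation, and the «bracket» bound (RH-FREE)

Cell `rh-explicit`, WEIL column, seat weil-1 gen19 (cc-s2-3's RELEASE 2026-08-26T07:51Z of PR Steps 0/1/4/5; THETA-ASSIGN v1.1 §6).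
For an admissible row `P`, a truncation radius `R ≥ a` and a mollifier index `k`, put
`GR_k := weilConv (P.GROdd R) (moll k)` and `TR_k := weilConv (P.TROdd R) (moll k)` (`WeilColumnTruncatedWitness`). Then:

* §0 both are Weil test functions (`isWeilTest_GRk`, `isWeilTest_TRk`: `G_R = G₀ψ_R` and `T_R` are continuous with compact
  support); `phi_eq_GRk_sub_TRk : P.phi k = GR_k − TR_k` (`gOdd_eq_GROdd_sub_TROdd` + `weilConv_sub_moll`);
* §1 POLARISATION: `Q(φ_k) = Q(TR_k) + [Q(GR_k) − W(GR_k ⋆ T̃R_k) − W(TR_k ⋆ G̃R_k)]` (`weilQuadratic_sub_polarisation`);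
* §4 THE BRACKET: if `‖ĜR_k(ρ)‖ ≤ W_G/‖ρ − ½‖` and `‖T̂R_k(ρ)‖ ≤ W_T/‖ρ − ½‖` at every nontrivial zero, then
  `Re[bracket] ≤ 0.0463·(197/196)·(W_G² + 2·W_G·W_T)` (`re_weilQuadratic_le_of_decay`, `norm_weilFunctional_bilinear_le_of_decay`),
  hence **`re_weilQuadratic_phi_le_truncated : Re Q(φ_k) ≤ Re Q(TR_k) + 0.0463·(197/196)·(W_G² + 2·W_G·W_T)`**;
* §4′ with Step 3 (`exists_norm_weilMellin_TROdd_moll_le`: `W_T` uniform in `R, k`) and a Step-2-shaped hypothesis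
  (`‖ĜR_k(ρ)‖ ≤ W_G(R)/‖ρ−½‖` for `R ≥ R₁`, all `k`, with `W_G(R) → 0`; cc-s2-3's `WeilColumnThetaPRStep2GRDecay`):
  **`exists_bracket_tendsto_zero : ∃ β, Tendsto β atTop (𝓝 0) ∧ ∀ k, ∀ R ≥ max a R₁, Re Q(φ_k) ≤ Re Q(TR_k) + β R`** — the `β`
  slot of Step 6 (`WeilColumnThetaPRStep6Limit`).

Upper-clause bookkeeping only; nothing here bears on the truth of RH.
-/

noncomputable section

set_option linter.dupNamespace false

open Complex Set MeasureTheory Filter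
open scoped Real Topology ComplexConjugate

namespace Summit.RiemannHypothesis.RiemannHypothesis.Theorems.WeilColumn.ThetaMellin

open Literature.NumberTheory.LFunctions Literature.NumberTheory.LFunctions.WeilContinuous ThetaParams

namespace ThetaParams

variable {P : ThetaParams}

/-! ## §0 `G_R`, `G_R⁻` and the two mollified pieces -/

/-- `2 ≤ m` for an admissible row. -/
private theorem two_le_m₄ {qn : ℕ} (hP : P.Admissible qn) : 2 ≤ P.m := le_trans (by norm_num) hP.three_le

/-- `G_R = G₀·ψ_R` is continuous. [folklore] -/
theorem continuous_GR {qn : ℕ} (hP : P.Admissible qn) (R : ℝ) : Continuous (P.GR R) := by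
  show Continuous fun x ↦ P.G₀ x * (smoothStep R x : ℂ)
  exact (continuous_G₀ hP).mul (Complex.continuous_ofReal.comp (continuous_smoothStep R))

/-- `G_R` has compact support (`⊆ [−R−1, a]`). [folklore] -/
theorem hasCompactSupport_GR {qn : ℕ} (hP : P.Admissible qn) (R : ℝ) : HasCompactSupport (P.GR R) := by
  refine HasCompactSupport.of_support_subset_isCompact (isCompact_Icc (a := -R - 1) (b := P.a)) fun x hx ↦ ?_
  rw [Function.mem_support] at hx
  by_contra h
  rw [mem_Icc, not_and_or, not_le, not_le] at h
  rcases h with h | h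
  · exact hx (P.GR_eq_zero_of_le (R := R) h.le)
  · exact hx (P.GR_eq_zero_of_lt hP h)

/-- `G_R⁻` is continuous. [folklore] -/
theorem continuous_GROdd {qn : ℕ} (hP : P.Admissible qn) (R : ℝ) : Continuous (P.GROdd R) := by
  show Continuous fun x ↦ P.GR R x - P.GR R (-x)
  exact (continuous_GR hP R).sub ((continuous_GR hP R).comp continuous_neg)

/-- `G_R⁻` has compact support. [folklore] -/
theorem hasCompactSupport_GROdd {qn : ℕ} (hP : P.Admissible qn) (R : ℝ) : HasCompactSupport (P.GROdd R) := by
  show HasCompactSupport fun x ↦ P.GR R x - P.GR R (-x)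
  exact (hasCompactSupport_GR hP R).sub ((hasCompactSupport_GR hP R).comp_homeomorph (Homeomorph.neg ℝ))

/-- `GR_k = G_R⁻ ⋆ moll_k` is a Weil test function. [folklore] -/
theorem isWeilTest_GRk {qn : ℕ} (hP : P.Admissible qn) (R : ℝ) (k : ℕ) : IsWeilTest (weilConv (P.GROdd R) (moll k)) :=
  isWeilTest_weilConv_moll (continuous_GROdd hP R) (hasCompactSupport_GROdd hP R) k

/-- `TR_k = T_R⁻ ⋆ moll_k` is a Weil test function. [folklore] -/
theorem isWeilTest_TRk {qn : ℕ} (hP : P.Admissible qn) (R : ℝ) (k : ℕ) : IsWeilTest (weilConv (P.TROdd R) (moll k)) :=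
  isWeilTest_weilConv_moll (continuous_TROdd hP R) (hasCompactSupport_TROdd hP R) k

/-- **`φ_k = GR_k − TR_k`** for every `R ≥ a`. [folklore] -/
theorem phi_eq_GRk_sub_TRk {qn : ℕ} (hP : P.Admissible qn) {R : ℝ} (hR : P.a ≤ R) (k : ℕ) :
    P.phi k = fun x ↦ weilConv (P.GROdd R) (moll k) x - weilConv (P.TROdd R) (moll k) x := by
  have hg : P.gOdd = fun u ↦ P.GROdd R u - P.TROdd R u :=
    funext fun u ↦ P.gOdd_eq_GROdd_sub_TROdd hR (fun x hx ↦ P.cut_eq_zero hP.eta_pos (by have := two_le_m₄ hP; omega) hx) u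
  funext x
  rw [phi, hg]
  exact weilConv_sub_moll (continuous_GROdd hP R) (continuous_TROdd hP R) k x

/-! ## §1 The polarisation -/

/-- **STEP 1 (polarisation)**: `Q(φ_k) = Q(TR_k) + (Q(GR_k) − W(GR_k ⋆ T̃R_k) − W(TR_k ⋆ G̃R_k))`. [cite: Bombieri2000Weil, §3] -/
theorem weilQuadratic_phi_eq_polarisation {qn : ℕ} (hP : P.Admissible qn) {R : ℝ} (hR : P.a ≤ R) (k : ℕ) :
    weilQuadratic (P.phi k) =
      weilQuadratic (weilConv (P.TROdd R) (moll k)) +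
        (weilQuadratic (weilConv (P.GROdd R) (moll k)) -
          weilFunctional (weilConv (weilConv (P.GROdd R) (moll k)) (weilReflect (weilConv (P.TROdd R) (moll k)))) -
          weilFunctional (weilConv (weilConv (P.TROdd R) (moll k)) (weilReflect (weilConv (P.GROdd R) (moll k))))) := by
  rw [phi_eq_GRk_sub_TRk hP hR k]
  exact weilQuadratic_sub_polarisation (isWeilTest_GRk hP R k) (isWeilTest_TRk hP R k)

/-! ## §4 The bracket bound -/

/-- **STEP 4 (the bracket)**: if `‖ĜR_k(ρ)‖ ≤ W_G/‖ρ − ½‖` and `‖T̂R_k(ρ)‖ ≤ W_T/‖ρ − ½‖` at every nontrivial zero (`W_G, W_T ≥ 0`),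
then `Re[Q(GR_k) − W(GR_k ⋆ T̃R_k) − W(TR_k ⋆ G̃R_k)] ≤ 0.0463·(197/196)·(W_G² + 2·W_G·W_T)`.
[cite: Ford2002Millennium, Lemma 3.3 (the constant 0.0463)] -/
theorem re_bracket_le {qn : ℕ} (hP : P.Admissible qn) (R : ℝ) (k : ℕ) {WG WT : ℝ} (hWG : 0 ≤ WG) (hWT : 0 ≤ WT)
    (hG : ∀ ρ : ℂ, ρ ∈ RHWave0.riemannZetaNontrivialZeros →
      ‖weilMellin (weilConv (P.GROdd R) (moll k)) ρ‖ ≤ WG / ‖ρ - 1 / 2‖)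
    (hT : ∀ ρ : ℂ, ρ ∈ RHWave0.riemannZetaNontrivialZeros →
      ‖weilMellin (weilConv (P.TROdd R) (moll k)) ρ‖ ≤ WT / ‖ρ - 1 / 2‖) :
    (weilQuadratic (weilConv (P.GROdd R) (moll k)) -
        weilFunctional (weilConv (weilConv (P.GROdd R) (moll k)) (weilReflect (weilConv (P.TROdd R) (moll k)))) -
        weilFunctional (weilConv (weilConv (P.TROdd R) (moll k)) (weilReflect (weilConv (P.GROdd R) (moll k))))).re ≤
      0.0463 * ((197 / 196) * (WG ^ 2 + 2 * (WG * WT))) := by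
  have hGk := isWeilTest_GRk hP R k
  have hTk := isWeilTest_TRk hP R k
  have h1 := re_weilQuadratic_le_of_decay hGk hG
  have h2 := norm_weilFunctional_bilinear_le_of_decay hGk hTk hWG hWT hG hT
  have h3 := norm_weilFunctional_bilinear_le_of_decay hTk hGk hWT hWG hT hG
  have h2' := (Complex.re_le_norm _).trans ((norm_neg _).le.trans h2)
  have h3' := (Complex.re_le_norm _).trans ((norm_neg _).le.trans h3)
  rw [Complex.neg_re] at h2' h3'
  simp only [Complex.sub_re]
  nlinarith

/-- **`Re Q(φ_k) ≤ Re Q(TR_k) + 0.0463·(197/196)·(W_G² + 2·W_G·W_T)`** (polarisation + bracket). [THETA-ASSIGN v1.1 §6 Steps 1/4] -/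
theorem re_weilQuadratic_phi_le_truncated {qn : ℕ} (hP : P.Admissible qn) {R : ℝ} (hR : P.a ≤ R) (k : ℕ) {WG WT : ℝ}
    (hWG : 0 ≤ WG) (hWT : 0 ≤ WT)
    (hG : ∀ ρ : ℂ, ρ ∈ RHWave0.riemannZetaNontrivialZeros →
      ‖weilMellin (weilConv (P.GROdd R) (moll k)) ρ‖ ≤ WG / ‖ρ - 1 / 2‖)
    (hT : ∀ ρ : ℂ, ρ ∈ RHWave0.riemannZetaNontrivialZeros →
      ‖weilMellin (weilConv (P.TROdd R) (moll k)) ρ‖ ≤ WT / ‖ρ - 1 / 2‖) :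
    (weilQuadratic (P.phi k)).re ≤
      (weilQuadratic (weilConv (P.TROdd R) (moll k))).re + 0.0463 * ((197 / 196) * (WG ^ 2 + 2 * (WG * WT))) := by
  rw [weilQuadratic_phi_eq_polarisation hP hR k, Complex.add_re]
  have := re_bracket_le hP R k hWG hWT hG hT
  linarith

/-! ## §4′ The bracket tends to `0` with `R` (Step 3's `W_T` and a Step-2-shaped `W_G(R) → 0`) -/

/-- A nontrivial zero has `0 ≤ Re ρ ≤ 1` and `ρ ≠ ½` (indeed `0 < Re ρ < 1`, `|Im ρ| > 14`). [folklore] -/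
theorem zero_re_bounds {ρ : ℂ} (hρ : ρ ∈ RHWave0.riemannZetaNontrivialZeros) : 0 ≤ ρ.re ∧ ρ.re ≤ 1 ∧ ρ ≠ 1 / 2 := by
  refine ⟨(ZetaZeros.riemannZetaNontrivialZeros.re_pos hρ).le, (ZetaZeros.riemannZetaNontrivialZeros.re_lt_one hρ).le, ?_⟩
  intro h
  have h14 := FordL33.fourteen_lt_abs_im ⟨ρ, hρ⟩
  simp only [h] at h14
  norm_num at h14

/-- **THE `β` SLOT OF STEP 6**: given the Step-2 decay `‖ĜR_k(ρ)‖ ≤ W_G(R)/‖ρ−½‖` for `R ≥ R₁` and all `k`, with `W_G ≥ 0` and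
`W_G(R) → 0`, and the lane's D2 hypotheses (Step 3's `W_T`, uniform in `R` and `k`), there is `β` with `β(R) → 0` and
`Re Q(φ_k) ≤ Re Q(TR_k) + β(R)` for every `k` and every `R ≥ max a R₁`. [THETA-ASSIGN v1.1 §6 Steps 1–4] -/
theorem exists_bracket_tendsto_zero {qn : ℕ} (hP : P.Admissible qn) {Θ' : ℝ → ℂ}
    (hΘ' : ∀ u : ℝ, 0 < u → HasDerivAt P.Θ (Θ' u) u) (hΘ'c : ContinuousOn Θ' (Ioi 0))
    (hM₁ : ∀ u ∈ Ioc (0 : ℝ) P.u₁, ‖(u : ℂ) * Θ' u‖ ≤ P.M₁ * (u / P.u₁) ^ (P.m - 1))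
    {WG : ℝ → ℝ} {R₁ : ℝ} (hWG0 : ∀ R, R₁ ≤ R → 0 ≤ WG R) (hWGlim : Tendsto WG atTop (𝓝 0))
    (hG : ∀ R : ℝ, R₁ ≤ R → ∀ k : ℕ, ∀ ρ : ℂ, ρ ∈ RHWave0.riemannZetaNontrivialZeros →
      ‖weilMellin (weilConv (P.GROdd R) (moll k)) ρ‖ ≤ WG R / ‖ρ - 1 / 2‖) :
    ∃ β : ℝ → ℝ, Tendsto β atTop (𝓝 0) ∧ ∀ (k : ℕ) (R : ℝ), max P.a R₁ ≤ R →
      (weilQuadratic (P.phi k)).re ≤ (weilQuadratic (weilConv (P.TROdd R) (moll k))).re + β R := by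
  obtain ⟨WT, hWT0, hWT⟩ := exists_norm_weilMellin_TROdd_moll_le hP hΘ' hΘ'c hM₁
  refine ⟨fun R ↦ 0.0463 * ((197 / 196) * (WG R ^ 2 + 2 * (WG R * WT))), ?_, fun k R hR ↦ ?_⟩
  · have h := ((hWGlim.pow 2).add ((hWGlim.mul_const WT).const_mul 2)).const_mul (197 / 196) |>.const_mul 0.0463
    simpa using h
  · have hRa : P.a ≤ R := le_trans (le_max_left _ _) hR
    have hR₁ : R₁ ≤ R := le_trans (le_max_right _ _) hR
    exact re_weilQuadratic_phi_le_truncated hP hRa k (hWG0 R hR₁) hWT0 (hG R hR₁ k)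
      (fun ρ hρ ↦ by
        obtain ⟨h0, h1, hne⟩ := zero_re_bounds hρ
        exact hWT R k ρ h0 h1 hne)

end ThetaParams

end Summit.RiemannHypothesis.RiemannHypothesis.Theorems.WeilColumn.ThetaMellin

end
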